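import Mathlib
import HarnessLib

/-!
# Dissipation-range closure: the quadratic shell recursion beyond the Kolmogorov shell
# (helper file for the crux `SubOnsagerCeiling.ForwardTailCeilingKP`, stmt-NavierStokesRegularity-27057, `--supports`)

For a non-negative viscous Katz–Pavlović chain `a_k' = c λ^{k-1} a_{k-1}² − c λ^k a_k a_{k+1} − ν b^{2k} a_k` (`λ = b^{5/2}`) the
drain is non-positive, so `a_{k+1}' ≤ c λ^k M_k² − ν b^{2(k+1)} a_{k+1}` with `M_k = sup_t a_k`, and the tree's linear slaving lemma
(`Theorems.linearSlaving_le`, file `SubOnsagerCeilingKPSideBranchClassDynamics`) gives the DISSIPATION-RANGE RECURSION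
`M_{k+1} ≤ A r^k M_k²` with `A = c/(ν b²)`, `r = λ/b² = b^{1/2} ≥ 1`.  This file is the pure real-sequence half of the
«viscous cut-off» brick (C) of the DG-front repair census (hand leafhand-4-g2, memo DG-FRONT-CENSUS): once ONE shell `k₀` is
sub-Kolmogorov, `A r^{k₀+1} M_{k₀} ≤ q < 1`, the recursion closes super-exponentially and every geometric weight is dominated:

* `kpDiss_normalised_step` — with `u_k := A r^{k+1} M_k` the recursion reads `u_{k+1} ≤ u_k²`;
* `kpDiss_superexp` — `u_{k+1} ≤ u_k²`, `u_{k₀} ≤ q` ⇒ `u_{k₀+j} ≤ q^{2^j}`;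
* `kpDiss_geomWeight_bounded` — `0 ≤ q < 1`, `0 < w` ⇒ `w^j q^{2^j}` is bounded in `j` (any geometric weight, e.g. `w = b^{2θ}`);
* `kpDiss_weighted_barrier` — the composite: beyond the Kolmogorov shell the weighted peaks `w^j · M_{k₀+j}²` are bounded, for EVERY `w > 0`.

The DG front exponent `y < 4/5` (memo Table A: `y ≤ 0.759`) is what guarantees that such a `k₀(ν)` exists along the front
(`λ^{y n}` turnover versus `ν λ^{4n/5}` damping); that half is dynamics and is NOT proved here. [cite: DombreGilson1998, §3]
[cite: BarbatoMorandinRomito2011, §3.2 (dissipation range of the dyadic model)]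

HONEST FRAMING: elementary real-sequence lemmas for a MODEL lattice ODE (route SubOnsagerCeiling, rung TL-M2Break); no stub, crux or
summit is proved here and nothing in this file bears on Navier–Stokes regularity.
-/

noncomputable section

-- the sub-problem namespace `NavierStokesRegularity.NavierStokesRegularity` is the tree's layout (D-0017)
set_option linter.dupNamespace false

namespace Summit.NavierStokesRegularity.NavierStokesRegularity.Theorems

open Finset

/-- **Normalised step.** If `M_{k+1} ≤ A r^k M_k²` with `A, r ≥ 0`, then with `u_k := A r^{k+1} M_k` one has
`u_{k+1} ≤ u_k²` (`A r^{k+2} · A r^k M_k² = (A r^{k+1} M_k)²`). [folklore; this file] -/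
theorem kpDiss_normalised_step {A r : ℝ} (hA : 0 ≤ A) (hr : 0 ≤ r) {M : ℕ → ℝ} {k : ℕ}
    (hrec : M (k + 1) ≤ A * r ^ k * M k ^ 2) :
    A * r ^ (k + 2) * M (k + 1) ≤ (A * r ^ (k + 1) * M k) ^ 2 := by
  have hw : 0 ≤ A * r ^ (k + 2) := mul_nonneg hA (pow_nonneg hr _)
  calc A * r ^ (k + 2) * M (k + 1) ≤ A * r ^ (k + 2) * (A * r ^ k * M k ^ 2) :=
        mul_le_mul_of_nonneg_left hrec hw
    _ = (A * r ^ (k + 1) * M k) ^ 2 := by ring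

/-- **Super-exponential closure.** If `0 ≤ u`, `u_{k+1} ≤ u_k²` for `k ≥ k₀` and `u_{k₀} ≤ q`, then `u_{k₀+j} ≤ q^{2^j}` for all `j`.
[folklore; this file] -/
theorem kpDiss_superexp {u : ℕ → ℝ} {k₀ : ℕ} {q : ℝ} (h0 : ∀ k, 0 ≤ u k)
    (hrec : ∀ k, k₀ ≤ k → u (k + 1) ≤ u k ^ 2) (hq : u k₀ ≤ q) :
    ∀ j : ℕ, u (k₀ + j) ≤ q ^ (2 ^ j) := by
  intro j
  induction j with
  | zero => simpa using hq
  | succ j ih =>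
    have hstep := hrec (k₀ + j) (Nat.le_add_right _ _)
    have hsq : u (k₀ + j) ^ 2 ≤ (q ^ (2 ^ j)) ^ 2 := pow_le_pow_left₀ (h0 _) ih 2
    calc u (k₀ + (j + 1)) = u (k₀ + j + 1) := by rw [Nat.add_assoc]
      _ ≤ u (k₀ + j) ^ 2 := hstep
      _ ≤ (q ^ (2 ^ j)) ^ 2 := hsq
      _ = q ^ (2 ^ (j + 1)) := by rw [← pow_mul]; ring_nf

/-- **Any geometric weight is dominated.** For `0 ≤ q < 1` and `0 < w` the sequence `w^j · q^{2^j}` is bounded: it is eventually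
non-increasing, since the ratio of consecutive terms is `w · q^{2^j} → 0`. [folklore; this file] -/
theorem kpDiss_geomWeight_bounded {q w : ℝ} (hq0 : 0 ≤ q) (hq1 : q < 1) (hw : 0 < w) :
    ∃ D : ℝ, 0 ≤ D ∧ ∀ j : ℕ, w ^ j * q ^ (2 ^ j) ≤ D := by
  -- q^{2^j} ≤ q^j → 0, so eventually w * q^{2^j} ≤ 1
  have hpow_le : ∀ j : ℕ, q ^ (2 ^ j) ≤ q ^ j := fun j =>
    pow_le_pow_of_le_one hq0 hq1.le (Nat.lt_two_pow_self).le
  have htend : Filter.Tendsto (fun j : ℕ => w * q ^ j) Filter.atTop (nhds 0) := by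
    simpa using (tendsto_pow_atTop_nhds_zero_of_lt_one hq0 hq1).const_mul w
  obtain ⟨J, hJ⟩ := (htend.eventually (gt_mem_nhds (show (0 : ℝ) < 1 by norm_num))).exists_forall_of_atTop
  -- the sequence
  set a : ℕ → ℝ := fun j => w ^ j * q ^ (2 ^ j) with ha
  have ha0 : ∀ j, 0 ≤ a j := fun j => mul_nonneg (pow_nonneg hw.le _) (pow_nonneg hq0 _)
  -- non-increasing from J on
  have hstep : ∀ j, J ≤ j → a (j + 1) ≤ a j := by
    intro j hj
    have hratio : w * q ^ (2 ^ j) ≤ 1 := by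
      have h1 : w * q ^ j < 1 := hJ j hj
      have h2 : w * q ^ (2 ^ j) ≤ w * q ^ j := mul_le_mul_of_nonneg_left (hpow_le j) hw.le
      linarith
    have heq : a (j + 1) = (w * q ^ (2 ^ j)) * a j := by
      simp only [ha]; rw [pow_succ, pow_succ, pow_mul, sq]; ring
    rw [heq]
    calc w * q ^ (2 ^ j) * a j ≤ 1 * a j := mul_le_mul_of_nonneg_right hratio (ha0 j)
      _ = a j := one_mul _
  have htail : ∀ i : ℕ, a (J + i) ≤ a J := by
    intro i
    induction i with
    | zero => simp
    | succ i ih =>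
      calc a (J + (i + 1)) = a (J + i + 1) := by rw [Nat.add_assoc]
        _ ≤ a (J + i) := hstep _ (Nat.le_add_right _ _)
        _ ≤ a J := ih
  -- bound: the max over the initial segment `0..J`
  set D : ℝ := (Finset.range (J + 1)).sum a with hD
  have hDge : ∀ j, j ≤ J → a j ≤ D := fun j hj =>
    Finset.single_le_sum (f := a) (fun i _ => ha0 i) (Finset.mem_range.2 (Nat.lt_succ_of_le hj))
  refine ⟨D, Finset.sum_nonneg fun i _ => ha0 i, fun j => ?_⟩
  by_cases hj : j ≤ J
  · exact hDge j hj
  · push Not at hj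
    obtain ⟨i, rfl⟩ := Nat.exists_eq_add_of_le hj.le
    exact (htail i).trans (hDge J le_rfl)

/-- **Dissipation-range barrier (composite).** Let `M_k ≥ 0` satisfy the dissipation-range recursion `M_{k+1} ≤ A r^k M_k²` for
`k ≥ k₀` with `A > 0`, `r ≥ 1`, and let shell `k₀` be sub-Kolmogorov: `A r^{k₀+1} M_{k₀} ≤ q < 1`. Then for EVERY weight `w > 0`
the weighted squared peaks beyond `k₀` are bounded: `∃ D ≥ 0, ∀ j, w^j · M_{k₀+j}² ≤ D`. (For the viscous KP chain: `A = c/(ν b²)`,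
`r = b^{1/2}`, `w = b^{2θ}`; `k₀ = k₀(ν)` exists along the front because the DG exponent `y < 4/5`.) [folklore; this file]
[cite: BarbatoMorandinRomito2011, §3.2] -/
theorem kpDiss_weighted_barrier {A r q w : ℝ} (hA : 0 < A) (hr : 1 ≤ r) (hq0 : 0 ≤ q) (hq1 : q < 1) (hw : 0 < w)
    {M : ℕ → ℝ} {k₀ : ℕ} (hM : ∀ k, 0 ≤ M k) (hrec : ∀ k, k₀ ≤ k → M (k + 1) ≤ A * r ^ k * M k ^ 2)
    (hK : A * r ^ (k₀ + 1) * M k₀ ≤ q) :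
    ∃ D : ℝ, 0 ≤ D ∧ ∀ j : ℕ, w ^ j * M (k₀ + j) ^ 2 ≤ D := by
  have hr0 : 0 ≤ r := le_trans zero_le_one hr
  -- normalised sequence
  set u : ℕ → ℝ := fun k => A * r ^ (k + 1) * M k with hu
  have hu0 : ∀ k, 0 ≤ u k := fun k => mul_nonneg (mul_nonneg hA.le (pow_nonneg hr0 _)) (hM k)
  have hurec : ∀ k, k₀ ≤ k → u (k + 1) ≤ u k ^ 2 := by
    intro k hk
    have := kpDiss_normalised_step hA.le hr0 (hrec k hk)
    simpa [hu, Nat.add_assoc] using this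
  have hsup := kpDiss_superexp hu0 hurec (by simpa [hu] using hK)
  obtain ⟨D, hD0, hD⟩ := kpDiss_geomWeight_bounded hq0 hq1 hw
  -- M_{k₀+j} ≤ u_{k₀+j} / (A r^{k₀+j+1}) ≤ u_{k₀+j} / A, and u ≤ q^{2^j} ≤ 1
  refine ⟨D / A ^ 2, by positivity, fun j => ?_⟩
  have hrp : 1 ≤ r ^ (k₀ + j + 1) := one_le_pow₀ hr
  have hMle : M (k₀ + j) ≤ u (k₀ + j) / A := by
    rw [le_div_iff₀ hA, hu]
    calc M (k₀ + j) * A = A * 1 * M (k₀ + j) := by ring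
      _ ≤ A * r ^ (k₀ + j + 1) * M (k₀ + j) :=
          mul_le_mul_of_nonneg_right (mul_le_mul_of_nonneg_left hrp hA.le) (hM _)
  have hule : u (k₀ + j) ≤ q ^ (2 ^ j) := hsup j
  have hq2le1 : q ^ (2 ^ j) ≤ 1 := pow_le_one₀ hq0 hq1.le
  have hM2 : M (k₀ + j) ^ 2 ≤ (q ^ (2 ^ j) / A) ^ 2 :=
    pow_le_pow_left₀ (hM _) (hMle.trans (div_le_div_of_nonneg_right hule hA.le)) 2
  calc w ^ j * M (k₀ + j) ^ 2 ≤ w ^ j * (q ^ (2 ^ j) / A) ^ 2 :=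
        mul_le_mul_of_nonneg_left hM2 (pow_nonneg hw.le _)
    _ = (w ^ j * q ^ (2 ^ j)) * q ^ (2 ^ j) / A ^ 2 := by ring
    _ ≤ (w ^ j * q ^ (2 ^ j)) * 1 / A ^ 2 := by
        gcongr
    _ ≤ D / A ^ 2 := by
        rw [mul_one]
        exact div_le_div_of_nonneg_right (hD j) (by positivity)

end Summit.NavierStokesRegularity.NavierStokesRegularity.Theorems
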